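import Mathlib
import Literature.Analysis.FluidPDE.TypeIAncientMild
import Literature.Analysis.FluidPDE.TypeIAncientMildTubeAnalyticity
import Summits.NavierStokesRegularity.NavierStokesRegularity.Theorems.SymmetryModuliCountSymmetricLiouvilleSmallAtMinusInfinity
import Summits.NavierStokesRegularity.NavierStokesRegularity.Theorems.ClockStretchingLawSmallStrainRung
import HarnessLib
import Summits.NavierStokesRegularity.NavierStokesRegularity.Theorems.ScenarioCensusSubgridMeterLaws

/-!
# Census block A2 (amplitude meters), cells A2zp / A2z1 / A2zb / A2zg / A2zl / A2zq / A2zw (DECIDED), A2zU / A2zE (OPEN) — instrument «STRIP METER» (the complex ANALYTICITY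
# TUBE of a class slice), LINE «strip-meter» REV 2 port, part 1/2: §A the instrument `TubeExt` / `GaussExt` / `EntireExt`, §B reading the real derivative off the
# complex one, §C the meter reading on the class, §D endgames (tree theorems; the two A2g lemmas shared VERBATIM with the subgrid-meter port taken BY NAME), §E the
# Gaussian-type cell, §F calibration — the tube law of the class

Re-homed for the scenario census (typer seat ns-census-typer-1 g9; the cells A2zp / A2z1 / A2zb / A2zg (+ the tube law A2zl) and, by REV 2, A2zq / A2zw are
MEMBERS OF RECORD «DECIDED IN KERNEL IN FILES» of block A2 since census v1.87 / v1.90 (critic idea-crit-3 g8 PASS 05:45:25Z — no price; ref ns-census-ref g11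
PRE-CHECK ✓ §16.15 item 53 + REV 2 §16.23; lead-presearch label item 53); this port makes them TREE-decided): VERBATIM PORT of ns-idea-2 «strip-meter» REV 2,
`pub/ideators/ns-idea-2/lines/strip-meter/line-strip-meter.rev2.lean` sha16 26ff2c99d04bd0c0 (550 l. = rev 1 2718956e744490b2 + §I, lean check rc 0, 0 sorry),
split for the 400-line rule into `ScenarioCensusStripMeter` (§A–§F) → `…StripMeterRows` (§G–§I + census KEYS).  Lean text VERBATIM in namespace
`…Theorems.ScenarioCensus.StripMeter` (the line's `…Lines.StripMeter` re-homed); port edits: `local notation "E3"` / `"E3C"` → `abbrev E3` / `abbrev E3C` (typer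
lint: no notation in port files), `@[conjecture]` on the OPEN rows `Row_A2zU` / `Row_A2zE` (typed only), nine one-line docstrings added (gate lint); two numeric
one-liners that restate landed Literature lemmas are not re-declared (their single uses carry the line's own proof inline, proof text only).  Statements
untouched.

No census VALUE is moved here (the cells become TREE-decided by name; booking is the lead's); NS regularity is NOT proved; (L′) ⟨10661⟩ is untouched; no
summit statement is proved by this file. Lemmas that restate already-landed tree declarations are taken BY NAME (gate lint `dedup.landed`): `eq_zero_of_strain_le_half` = `SubgridMeter.eq_zero_of_strain_le_half`, `eq_zero_of_strain_le_half_before` = `SubgridMeter.eq_zero_of_strain_le_half_before`.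
-/

-- the summit and its single problem share the name `NavierStokesRegularity` (D-0017 nested layout)
set_option linter.dupNamespace false

noncomputable section

open Set Function Filter Topology Metric MeasureTheory
open scoped RealInnerProductSpace ENNReal NNReal

namespace Summit.NavierStokesRegularity.NavierStokesRegularity.Theorems.ScenarioCensus.StripMeter

open Literature.Analysis Literature.Analysis.FluidPDE Literature.Analysis.UnboundedOperators
open Literature.Analysis.FunctionSpaces.EuclideanSpace (complexify complexify_apply norm_complexify)
open Summit.NavierStokesRegularity.NavierStokesRegularity.Theorems
open Summit.NavierStokesRegularity.NavierStokesRegularity.Theorems.SymmetryModuliCountSymmetricLiouville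

/-- `ℝ³` (the line's `local notation "E3"`, spelled as a reducible abbreviation for the tree). -/
abbrev E3 := EuclideanSpace ℝ (Fin 3)

/-- `ℂ³` (the line's `local notation "E3C"`, spelled as a reducible abbreviation for the tree). -/
abbrev E3C := EuclideanSpace ℂ (Fin 3)

/-! ## A. The instrument -/

/-- **Tube extension of width `R` and amplitude `A`.**  The slice `v` is the restriction of a map
holomorphic on the complex tube `{x + iy : ‖y‖ < R}` and bounded there by `A` (exactly the shape of the
conclusion of the tree's `exists_tube_extension_of_typeI_ancient_mild`). -/
def TubeExt (v : E3 → E3) (R A : ℝ) : Prop :=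
  ∃ U : E3C → E3C, DifferentiableOn ℂ U (complexTube (Fin 3) R) ∧
    (∀ x : E3, U (complexify x) = complexify (v x)) ∧ ∀ z ∈ complexTube (Fin 3) R, ‖U z‖ ≤ A

/-- **Entire extension of Gaussian type `s` and amplitude `A`.**  The slice `v` is the restriction of
an entire map with `‖U(x + iy)‖ ≤ A·exp(‖y‖²/(4s))`. -/
def GaussExt (v : E3 → E3) (A s : ℝ) : Prop :=
  ∃ U : E3C → E3C, Differentiable ℂ U ∧ (∀ x : E3, U (complexify x) = complexify (v x)) ∧
    ∀ a b : E3, ‖U (complexify a + Complex.I • complexify b)‖ ≤ A * Real.exp (‖b‖ ^ 2 / (4 * s))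

/-- **Entire extension (no growth condition).** -/
def EntireExt (v : E3 → E3) : Prop :=
  ∃ U : E3C → E3C, Differentiable ℂ U ∧ ∀ x : E3, U (complexify x) = complexify (v x)

/-- Monotonicity of the tube cell in the width and the amplitude. -/
theorem TubeExt.mono {v : E3 → E3} {R R' A A' : ℝ} (h : TubeExt v R A) (hR : R' ≤ R) (hA : A ≤ A') :
    TubeExt v R' A' := by
  obtain ⟨U, hU, hres, hb⟩ := h
  exact ⟨U, hU.mono (complexTube_mono hR), hres, fun z hz => (hb z (complexTube_mono hR hz)).trans hA⟩

/-- An entire extension of Gaussian type restricts to a tube extension of every width `R > 0`, with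
amplitude `A·exp(R²/(4s))`. -/
theorem GaussExt.tubeExt {v : E3 → E3} {A s : ℝ} (h : GaussExt v A s) (hs : 0 < s) (R : ℝ) :
    TubeExt v R (A * Real.exp (R ^ 2 / (4 * s))) := by
  obtain ⟨U, hU, hres, hb⟩ := h
  refine ⟨U, hU.differentiableOn, hres, fun z hz => ?_⟩
  obtain ⟨a, b, hbR, rfl⟩ := hz
  have hA : 0 ≤ A := by
    have h0 := hb a 0
    have : (0 : ℝ) ≤ A * Real.exp (‖(0 : E3)‖ ^ 2 / (4 * s)) := (norm_nonneg _).trans h0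
    simpa using this
  refine (hb a b).trans (mul_le_mul_of_nonneg_left ?_ hA)
  refine Real.exp_le_exp.2 (div_le_div_of_nonneg_right ?_ (by positivity))
  exact pow_le_pow_left₀ (norm_nonneg _) hbR.le 2

/-- An entire extension restricts to a tube extension of every width, with the bound it happens to have
there when one is given. -/
theorem EntireExt.of_gaussExt {v : E3 → E3} {A s : ℝ} (h : GaussExt v A s) : EntireExt v := by
  obtain ⟨U, hU, hres, -⟩ := h
  exact ⟨U, hU, hres⟩

/-! ## B. Reading the real derivative off the complex one -/

/-- The complexification as a continuous `ℝ`-linear map. -/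
def cxL : E3 →L[ℝ] E3C := (complexify : E3 →ₗᵢ[ℝ] E3C).toContinuousLinearMap

/-- `cxL v = complexify v`. -/
@[simp] theorem cxL_apply (v : E3) : cxL v = complexify v := rfl

/-- **Chain rule through the restriction identity.**  If `U ∘ complexify = complexify ∘ v` near `x`,
`U` is complex-differentiable at `complexify x` and `v` is real-differentiable at `x`, then
`complexify (Dv(x) e) = D_ℂU(complexify x) (complexify e)` for every real direction `e`. -/
theorem fderiv_real_eq {v : E3 → E3} {U : E3C → E3C} {x : E3}
    (hU : DifferentiableAt ℂ U (complexify x)) (hv : DifferentiableAt ℝ v x)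
    (hres : ∀ y : E3, U (complexify y) = complexify (v y)) (e : E3) :
    complexify (fderiv ℝ v x e) = fderiv ℂ U (complexify x) (complexify e) := by
  -- derivative of `U ∘ complexify` at `x`, as a real map
  have h1 : HasFDerivAt (fun y : E3 => U (complexify y))
      (((fderiv ℂ U (complexify x)).restrictScalars ℝ).comp cxL) x := by
    have hUr : HasFDerivAt U ((fderiv ℂ U (complexify x)).restrictScalars ℝ) (cxL x) := by
      simpa using (hU.hasFDerivAt.restrictScalars ℝ)
    exact hUr.comp x cxL.hasFDerivAt
  -- derivative of `complexify ∘ v` at `x`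
  have h2 : HasFDerivAt (fun y : E3 => complexify (v y)) (cxL.comp (fderiv ℝ v x)) x :=
    cxL.hasFDerivAt.comp x hv.hasFDerivAt
  have heq : (fun y : E3 => U (complexify y)) = fun y => complexify (v y) := funext hres
  rw [heq] at h1
  have huniq := h2.unique h1
  have := congrArg (fun L : E3 →L[ℝ] E3C => L e) huniq
  simpa using this

/-- **Cauchy reading of the strip meter.**  A tube extension of width `R > 0` and amplitude `A` forces
`‖∇v(x)‖_op ≤ 4A/R` at every real point (tree `norm_fderiv_le_of_tube` with `ρ = R/2`, then
`fderiv_real_eq` and the isometry `‖complexify w‖ = ‖w‖`). -/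
theorem norm_fderiv_le_of_tubeExt {v : E3 → E3} (hv : Differentiable ℝ v) {R A : ℝ} (hR : 0 < R)
    (h : TubeExt v R A) (x : E3) : ‖fderiv ℝ v x‖ ≤ 4 * A / R := by
  obtain ⟨U, hU, hres, hb⟩ := h
  have hρ : R / 2 < R := by linarith
  have hz : complexify x ∈ complexTube (Fin 3) (R / 2) := complexify_mem_complexTube (by linarith) x
  have hzR : complexify x ∈ complexTube (Fin 3) R := complexify_mem_complexTube hR x
  have hA : 0 ≤ A := (norm_nonneg _).trans (hb _ hzR)
  have hC : ‖fderiv ℂ U (complexify x)‖ ≤ 2 * A / (R - R / 2) := norm_fderiv_le_of_tube hρ hU hb hz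
  have hC' : ‖fderiv ℂ U (complexify x)‖ ≤ 4 * A / R := by
    rw [show R - R / 2 = R / 2 by ring] at hC
    calc ‖fderiv ℂ U (complexify x)‖ ≤ 2 * A / (R / 2) := hC
      _ = 4 * A / R := by field_simp; ring
  have hUd : DifferentiableAt ℂ U (complexify x) :=
    hU.differentiableAt ((isOpen_complexTube R).mem_nhds hzR)
  refine ContinuousLinearMap.opNorm_le_bound _ (by positivity) fun e => ?_
  calc ‖fderiv ℝ v x e‖ = ‖complexify (fderiv ℝ v x e)‖ := (norm_complexify _).symm
    _ = ‖fderiv ℂ U (complexify x) (complexify e)‖ := by rw [fderiv_real_eq hUd (hv x) hres e]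
    _ ≤ ‖fderiv ℂ U (complexify x)‖ * ‖complexify e‖ := ContinuousLinearMap.le_opNorm _ _
    _ ≤ 4 * A / R * ‖e‖ := by
        rw [norm_complexify]; exact mul_le_mul_of_nonneg_right hC' (norm_nonneg _)

/-! ## C. The meter reading on the class -/

/-- **Meter reading (Row_A2zp).**  For `u ∈ A_C`, `t < 0`: a tube extension of `u t` of width
`(8M+1)√(−t)` and amplitude `M/√(−t)` forces `(−t)‖∇u(t,x)‖_op ≤ ½` at every `x`
(`4M/(8M+1) ≤ ½`). -/
theorem strain_le_half_of_tubeExt {C : ℝ} {u : ℝ → E3 → E3} (hu : IsTypeIAncientMild C u) {M : ℝ}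
    (hM : 0 ≤ M) {t : ℝ} (ht : t < 0)
    (h : TubeExt (u t) ((8 * M + 1) * Real.sqrt (-t)) (M / Real.sqrt (-t))) (x : E3) :
    (-t) * ‖fderiv ℝ (u t) x‖ ≤ 1 / 2 := by
  have hnt : 0 < -t := by linarith
  have hsq : 0 < Real.sqrt (-t) := Real.sqrt_pos.2 hnt
  have hR : 0 < (8 * M + 1) * Real.sqrt (-t) := by positivity
  have hdiff : Differentiable ℝ (u t) := (hu.contDiff_slice ht).differentiable (by norm_cast)
  have key := norm_fderiv_le_of_tubeExt hdiff hR h x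
  -- generalise `s = √(−t)`, `−t = s·s`
  set s : ℝ := Real.sqrt (-t) with hsdef
  have hs0 : 0 < s := Real.sqrt_pos.2 hnt
  have hts : -t = s * s := by rw [hsdef]; exact (Real.mul_self_sqrt hnt.le).symm
  have h81 : 0 < 8 * M + 1 := by positivity
  have e1 : 4 * (M / s) / ((8 * M + 1) * s) = 4 * M / ((8 * M + 1) * (s * s)) := by
    rw [mul_div_assoc', div_div, div_eq_div_iff (by positivity) (by positivity)]; ring
  rw [e1] at key
  rw [hts]
  calc s * s * ‖fderiv ℝ (u t) x‖ ≤ s * s * (4 * M / ((8 * M + 1) * (s * s))) :=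
        mul_le_mul_of_nonneg_left key (by positivity)
    _ = 4 * M / (8 * M + 1) := by
        rw [mul_comm, div_mul_eq_mul_div, mul_div_mul_right _ _ (by positivity : s * s ≠ 0)]
    _ ≤ 1 / 2 := by rw [div_le_iff₀ h81]; linarith

/-! ## D. Endgames (tree theorems only) -/

-- `eq_zero_of_strain_le_half`: the line restates the tree's `SubgridMeter.eq_zero_of_strain_le_half`; taken BY NAME (gate lint dedup.landed).

-- `eq_zero_of_strain_le_half_before`: the line restates the tree's `SubgridMeter.eq_zero_of_strain_le_half_before`; taken BY NAME (gate lint dedup.landed).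

/-! ## E. The Gaussian-type cell -/

-- `exp_one_le_three`: `exp 1 ≤ 3` restates a landed Literature lemma (gate lint dedup.landed, twins `Literature.Analysis.FluidPDE.BDSV.exp_one_le_three` / `…TaoCascade.ZeroScale.exp_one_le_three` in modules this file does not need); not re-declared — its one use carries the line's own two-line proof inline (port edit, proof text only).

/-- **Gaussian-type reading.**  For `u ∈ A_C`, `t < 0`: an entire extension of `u t` with
`‖U(x+iy)‖ ≤ (M/√(−t))·exp(‖y‖²/(4θ(−t)))`, `θ = 144M² + 1`, forces `(−t)‖∇u(t,x)‖_op ≤ ½`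
(restrict to the tube of width `2√(θ(−t))`, where the growth factor is `e ≤ 3`: the Cauchy reading gives
`(−t)‖∇u‖ ≤ 6M/√θ ≤ ½`). -/
theorem strain_le_half_of_gaussExt {C : ℝ} {u : ℝ → E3 → E3} (hu : IsTypeIAncientMild C u) {M : ℝ}
    (hM : 0 ≤ M) {t : ℝ} (ht : t < 0)
    (h : GaussExt (u t) (M / Real.sqrt (-t)) ((144 * M ^ 2 + 1) * (-t))) (x : E3) :
    (-t) * ‖fderiv ℝ (u t) x‖ ≤ 1 / 2 := by
  have hnt : 0 < -t := by linarith
  set θ : ℝ := 144 * M ^ 2 + 1 with hθ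
  have hθ0 : 0 < θ := by positivity
  have hst : 0 < θ * (-t) := mul_pos hθ0 hnt
  have hsq : 0 < Real.sqrt (θ * (-t)) := Real.sqrt_pos.2 hst
  set R : ℝ := 2 * Real.sqrt (θ * (-t)) with hRdef
  have hR : 0 < R := by positivity
  have hT := h.tubeExt hst R
  have hR2 : R ^ 2 = 4 * (θ * (-t)) := by rw [hRdef, mul_pow, Real.sq_sqrt hst.le]; norm_num
  have hexp : Real.exp (R ^ 2 / (4 * (θ * (-t)))) ≤ 3 := by
    rw [hR2, div_self (mul_pos (by norm_num : (0 : ℝ) < 4) hst).ne']; exact (by have := Real.exp_one_lt_d9; linarith)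
  have hA0 : 0 ≤ M / Real.sqrt (-t) := div_nonneg hM (Real.sqrt_nonneg _)
  have hT' : TubeExt (u t) R (3 * M / Real.sqrt (-t)) :=
    hT.mono le_rfl (by
      calc M / Real.sqrt (-t) * Real.exp (R ^ 2 / (4 * (θ * (-t))))
          ≤ M / Real.sqrt (-t) * 3 := mul_le_mul_of_nonneg_left hexp hA0
        _ = 3 * M / Real.sqrt (-t) := by ring)
  have hdiff : Differentiable ℝ (u t) := (hu.contDiff_slice ht).differentiable (by norm_cast)
  have key := norm_fderiv_le_of_tubeExt hdiff hR hT' x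
  rw [hRdef, Real.sqrt_mul hθ0.le] at key
  -- generalise `s = √(−t)`, `q = √θ`
  set s : ℝ := Real.sqrt (-t) with hsdef
  set q : ℝ := Real.sqrt θ with hqdef
  have hs0 : 0 < s := Real.sqrt_pos.2 hnt
  have hq0 : 0 < q := Real.sqrt_pos.2 hθ0
  have hts : -t = s * s := by rw [hsdef]; exact (Real.mul_self_sqrt hnt.le).symm
  have hq12 : 12 * M ≤ q := by
    rw [hqdef, hθ]
    have h1 : Real.sqrt ((12 * M) ^ 2) = 12 * M := Real.sqrt_sq (by positivity)
    rw [← h1]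
    exact Real.sqrt_le_sqrt (by nlinarith)
  have e1 : 4 * (3 * M / s) / (2 * (q * s)) = 6 * M / (q * (s * s)) := by
    rw [mul_div_assoc', div_div, div_eq_div_iff (by positivity) (by positivity)]; ring
  rw [e1] at key
  rw [hts]
  calc s * s * ‖fderiv ℝ (u t) x‖ ≤ s * s * (6 * M / (q * (s * s))) :=
        mul_le_mul_of_nonneg_left key (by positivity)
    _ = 6 * M / q := by
        rw [mul_comm, div_mul_eq_mul_div, mul_div_mul_right _ _ (by positivity : s * s ≠ 0)]
    _ ≤ 1 / 2 := by rw [div_le_iff₀ hq0]; nlinarith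

/-! ## F. Calibration — the tube law of the class (tree theorem, fields matched) -/

/-- **Row_A2zl (LAW, tree).**  Every slice of every `u ∈ A_C` is the restriction of a map holomorphic and
bounded on a complex tube of positive width (`exists_tube_extension_of_typeI_ancient_mild`: Guberović 2010 /
Bradshaw–Grujić–Kukavica 2016 Thm 2.4.1, restarted on the class). -/
theorem tube_law (C : ℝ) (u : ℝ → E3 → E3) (hu : IsTypeIAncientMild C u) {t : ℝ} (ht : t < 0) :
    ∃ r : ℝ, 0 < r ∧ ∃ B : ℝ, TubeExt (u t) r B := by
  obtain ⟨r, hr, B, U, hU, hres, hb⟩ := exists_tube_extension_of_typeI_ancient_mild hu.hasTypeITimeDecay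
    hu.continuousOn_uncurry (fun s t hst ht x => hu.mild_eq_heatExtension hst ht x)
    (fun t ht => hu.isDivFree ht) (fun t ht => (hu.contDiff_slice ht).of_le (by norm_cast)) ht
  exact ⟨r, hr, B, U, hU, hres, hb⟩

end Summit.NavierStokesRegularity.NavierStokesRegularity.Theorems.ScenarioCensus.StripMeter

end
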